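import Summits.QuantumFields.YangMills.Theorems.ColdStartUniversalityColdStartSolutionsExistSpanRange
import Summits.QuantumFields.YangMills.Theorems.ColdStartUniversalityColdStartSolutionsExistQuaternion
import Mathlib.Analysis.Matrix.Normed
import HarnessLib

/-!
# Route `ColdStartUniversality`, support item S (stmt-QuantumFields-24811), line `piwiener`:
# stub C, analytic part — radial truncation, four-fold products, the 𝔤-drift on bounded configurations
# (Frobenius bounds and Lipschitz estimates)

Helper file (lead `ym-line-csu-p1`), the analytic bounds behind the registered stub C
`stub_truncatedCoefficients` of the skeleton `Cruxes/ColdStartSolutionsExist/Lines/piwiener.lean` (assembled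
in the sibling `…Truncated`):

* Part 1: the radial truncation `t(M) = (3 / max ‖M‖_F² 3) M` on `M_N(ℂ)` (identity on the Frobenius ball
  `‖M‖² ≤ 3 ⊇ U(2)`), its bound `‖t M‖² ≤ 3` and Lipschitz estimate `‖t M − t M'‖ ≤ 3 ‖M − M'‖`; the
  contraction `‖𝐩 M‖ ≤ ‖M‖` of the Hilbert–Schmidt projection; the bridge `hsForm N M M = ‖M‖_F²` to
  Mathlib's Frobenius norm (scoped instance `Matrix.Norms.Frobenius`, used in proofs only — all
  statements consumed downstream are instance-free);
* Part 2: the rooted plaquette loops and the `𝔤`-drift `driftLie` are bounded and Lipschitz in the links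
  on Frobenius-bounded configurations (telescoping of four-fold products);
No definition, no sorry, standard axioms.  RECORD-rung plumbing; nothing here bears on the mass gap.
-/

set_option autoImplicit false

noncomputable section

namespace Summit.QuantumFields.YangMills.Theorems.ColdStartUniversality

open Matrix Complex Finset
open scoped ComplexConjugate BigOperators Matrix.Norms.Frobenius
open Literature.MathematicalPhysics.QuantumFieldTheory

section Frobenius

variable {N : ℕ}

/-- Bridge: the tree's `hsForm N M M = Σᵢⱼ |M i j|²` is the square of Mathlib's Frobenius norm. [folklore] -/
theorem hsForm_self_eq_norm_sq (M : Matrix (Fin N) (Fin N) ℂ) : hsForm N M M = ‖M‖ ^ 2 := by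
  rw [hsForm_self, Matrix.frobenius_norm_def, ← Real.rpow_natCast _ 2,
    ← Real.rpow_mul (Finset.sum_nonneg fun i _ => Finset.sum_nonneg fun j _ => by positivity)]
  norm_num

/-- `hsForm` of a difference with itself is the squared Frobenius distance. [folklore] -/
theorem hsForm_sub_self_eq_norm_sq (M M' : Matrix (Fin N) (Fin N) ℂ) :
    hsForm N (M - M') (M - M') = ‖M - M'‖ ^ 2 :=
  hsForm_self_eq_norm_sq _

/-- **The Hilbert–Schmidt projection onto `𝔤` is a contraction**: `⟨𝐩M, 𝐩M⟩ ≤ ⟨M, M⟩`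
(`M = 𝐩M + (M − 𝐩M)` with `𝐩M ⊥ M − 𝐩M`). [folklore] -/
theorem hsForm_lieProj_self_le {G : Type*} [Group G] [TopologicalSpace G] (r : LatticeRep G)
    (M : Matrix (Fin r.N) (Fin r.N) ℂ) :
    hsForm r.N (r.lieProj M) (r.lieProj M) ≤ hsForm r.N M M := by
  have horth : hsForm r.N (r.lieProj M) (M - r.lieProj M) = 0 := r.hsForm_sub_lieProj (r.lieProj_mem M)
  have hdecomp : hsForm r.N M M = hsForm r.N (r.lieProj M) (r.lieProj M) +
      2 * hsForm r.N (r.lieProj M) (M - r.lieProj M) + hsForm r.N (M - r.lieProj M) (M - r.lieProj M) := by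
    have hM : M = r.lieProj M + (M - r.lieProj M) := by abel
    conv_lhs => rw [hM]
    simp only [map_add, map_sub, LinearMap.add_apply, LinearMap.sub_apply]
    have hc := hsForm_comm (r.lieProj M) M
    linarith [hsForm_comm (r.lieProj M) M, hsForm_comm (M - r.lieProj M) (r.lieProj M)]
  rw [hdecomp, horth]
  linarith [hsForm_self_nonneg (M - r.lieProj M)]

/-- `‖𝐩 M‖_F ≤ ‖M‖_F`. [folklore] -/
theorem norm_lieProj_le {G : Type*} [Group G] [TopologicalSpace G] (r : LatticeRep G)
    (M : Matrix (Fin r.N) (Fin r.N) ℂ) : ‖r.lieProj M‖ ≤ ‖M‖ := by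
  have h := hsForm_lieProj_self_le r M
  rw [hsForm_self_eq_norm_sq, hsForm_self_eq_norm_sq] at h
  exact (pow_le_pow_iff_left₀ (norm_nonneg _) (norm_nonneg _) two_ne_zero).1 h

/-- `‖𝐩(Eₙ)‖_F ≤ 1` for the canonical orthonormal directions. [folklore] -/
theorem norm_lieProj_noiseDir_le {G : Type*} [Group G] [TopologicalSpace G] (r : LatticeRep G)
    (n : NoiseIdx r.N) : ‖r.lieProj (noiseDir n)‖ ≤ 1 := by
  refine (norm_lieProj_le r _).trans ?_
  have h : hsForm r.N (noiseDir n) (noiseDir n) = 1 := by rw [hsForm_noiseDir]; simp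
  rw [hsForm_self_eq_norm_sq] at h
  nlinarith [norm_nonneg (noiseDir (N := r.N) n)]

/-- Real scalars come out of the second argument of `hsForm`. [folklore] -/
theorem hsForm_real_smul_right (c : ℝ) (X Y : Matrix (Fin N) (Fin N) ℂ) :
    hsForm N X (c • Y) = c * hsForm N X Y := by
  rw [hsForm_comm, hsForm_real_smul_left, hsForm_comm]

/-! ### The radial truncation -/

/-- The truncation factor `3 / max ‖M‖² 3` lies in `(0, 1]`. [folklore] -/
theorem truncFactor_pos (M : Matrix (Fin N) (Fin N) ℂ) : 0 < (3 : ℝ) / max (hsForm N M M) 3 :=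
  div_pos (by norm_num) (lt_max_of_lt_right (by norm_num))

/-- The truncation factor is at most `1`. [folklore] -/
theorem truncFactor_le_one (M : Matrix (Fin N) (Fin N) ℂ) : (3 : ℝ) / max (hsForm N M M) 3 ≤ 1 :=
  (div_le_one (lt_max_of_lt_right (by norm_num))).2 (le_max_right _ _)

/-- On the ball `‖M‖² ≤ 3` the truncation is the identity. [folklore] -/
theorem trunc_eq_self_of_le {M : Matrix (Fin N) (Fin N) ℂ} (h : hsForm N M M ≤ 3) :
    ((3 : ℝ) / max (hsForm N M M) 3) • M = M := by
  rw [max_eq_right h, div_self (by norm_num : (3 : ℝ) ≠ 0), one_smul]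

/-- **The truncated matrix has `‖t M‖² ≤ 3`.** [folklore] -/
theorem hsForm_trunc_self_le (M : Matrix (Fin N) (Fin N) ℂ) :
    hsForm N (((3 : ℝ) / max (hsForm N M M) 3) • M) (((3 : ℝ) / max (hsForm N M M) 3) • M) ≤ 3 := by
  rw [hsForm_real_smul_left, hsForm_real_smul_right]
  set m := max (hsForm N M M) 3 with hm
  have hm3 : 3 ≤ m := le_max_right _ _
  have hMm : hsForm N M M ≤ m := le_max_left _ _
  have hm0 : 0 < m := by linarith
  have hnn := hsForm_self_nonneg M
  rw [show (3 : ℝ) / m * (3 / m * hsForm N M M) = 9 * hsForm N M M / m ^ 2 by field_simp; ring]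
  rw [div_le_iff₀ (by positivity)]
  nlinarith

/-- `‖t M‖ ≤ √3`. [folklore] -/
theorem norm_trunc_le (M : Matrix (Fin N) (Fin N) ℂ) :
    ‖((3 : ℝ) / max (hsForm N M M) 3) • M‖ ≤ Real.sqrt 3 := by
  have h := hsForm_trunc_self_le M
  rw [hsForm_self_eq_norm_sq] at h
  exact Real.le_sqrt_of_sq_le h

/-- Real-variable core of the Lipschitz estimate of the truncation factor:
`|3/m − 3/m'|·b ≤ 2|a − b|` for `m = max a² 3`, `m' = max b² 3` (abstracted). [folklore] -/
theorem truncFactor_aux (a b m m' : ℝ) (ha : 0 ≤ a) (hb : 0 ≤ b) (hm3 : 3 ≤ m) (hm'3 : 3 ≤ m')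
    (ham : a ^ 2 ≤ m) (hbm : b ^ 2 ≤ m') (hmm : |m - m'| ≤ |a ^ 2 - b ^ 2|) :
    |3 / m - 3 / m'| * b ≤ 2 * |a - b| := by
  have hm0 : 0 < m := by linarith
  have hm'0 : 0 < m' := by linarith
  have hsq : |a ^ 2 - b ^ 2| = |a - b| * (a + b) := by
    rw [show a ^ 2 - b ^ 2 = (a - b) * (a + b) by ring, abs_mul,
      abs_of_nonneg (show (0 : ℝ) ≤ a + b by linarith)]
  have hkey : 3 * ((a + b) * b) ≤ 2 * (m * m') := by
    nlinarith [mul_nonneg (sub_nonneg.2 hm3) (by linarith : (0 : ℝ) ≤ 2 * m' - 3 / 2),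
      sq_nonneg (a - b), ham, hbm, hm'3, hb, ha]
  rw [div_sub_div _ _ hm0.ne' hm'0.ne', abs_div, abs_of_pos (mul_pos hm0 hm'0),
    show (3 : ℝ) * m' - m * 3 = 3 * (m' - m) by ring, abs_mul, abs_of_pos (by norm_num : (0:ℝ) < 3),
    abs_sub_comm, div_mul_eq_mul_div, div_le_iff₀ (mul_pos hm0 hm'0)]
  calc 3 * |m - m'| * b ≤ 3 * (|a - b| * (a + b)) * b := by rw [← hsq]; gcongr
    _ = |a - b| * (3 * ((a + b) * b)) := by ring
    _ ≤ |a - b| * (2 * (m * m')) := by gcongr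
    _ = 2 * |a - b| * (m * m') := by ring

/-- **The radial truncation is `3`-Lipschitz** for the Frobenius norm:
`‖t M − t M'‖ ≤ 3 ‖M − M'‖`.  (`t M − t M' = g(M)(M − M') + (g(M) − g(M'))M'`, `0 < g ≤ 1`,
`|g(M) − g(M')| ‖M'‖ ≤ 2‖M − M'‖`.) [folklore] -/
theorem norm_trunc_sub_trunc_le (M M' : Matrix (Fin N) (Fin N) ℂ) :
    ‖((3 : ℝ) / max (hsForm N M M) 3) • M - ((3 : ℝ) / max (hsForm N M' M') 3) • M'‖ ≤ 3 * ‖M - M'‖ := by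
  rw [hsForm_self_eq_norm_sq, hsForm_self_eq_norm_sq]
  have hm0 : 0 < max (‖M‖ ^ 2) 3 := lt_max_of_lt_right (by norm_num : (3 : ℝ) > 0)
  have hg0 : 0 < (3 : ℝ) / max (‖M‖ ^ 2) 3 := div_pos (by norm_num) hm0
  have hsplit : ‖((3 : ℝ) / max (‖M‖ ^ 2) 3) • M - ((3 : ℝ) / max (‖M'‖ ^ 2) 3) • M'‖ ≤
      3 / max (‖M‖ ^ 2) 3 * ‖M - M'‖ + |3 / max (‖M‖ ^ 2) 3 - 3 / max (‖M'‖ ^ 2) 3| * ‖M'‖ := by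
    have e1 : ((3 : ℝ) / max (‖M‖ ^ 2) 3) • M - ((3 : ℝ) / max (‖M'‖ ^ 2) 3) • M' =
        ((3 : ℝ) / max (‖M‖ ^ 2) 3) • (M - M') +
          ((3 : ℝ) / max (‖M‖ ^ 2) 3 - (3 : ℝ) / max (‖M'‖ ^ 2) 3) • M' := by
      rw [smul_sub, sub_smul, sub_add_sub_cancel]
    calc _ = ‖((3 : ℝ) / max (‖M‖ ^ 2) 3) • (M - M') +
          ((3 : ℝ) / max (‖M‖ ^ 2) 3 - (3 : ℝ) / max (‖M'‖ ^ 2) 3) • M'‖ := by rw [e1]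
      _ ≤ ‖((3 : ℝ) / max (‖M‖ ^ 2) 3) • (M - M')‖ +
          ‖((3 : ℝ) / max (‖M‖ ^ 2) 3 - (3 : ℝ) / max (‖M'‖ ^ 2) 3) • M'‖ := norm_add_le _ _
      _ = _ := by
          rw [norm_smul, norm_smul, Real.norm_eq_abs, Real.norm_eq_abs, abs_of_pos hg0]
  have h1 : 3 / max (‖M‖ ^ 2) 3 * ‖M - M'‖ ≤ ‖M - M'‖ :=
    mul_le_of_le_one_left (norm_nonneg _) ((div_le_one hm0).2 (le_max_right (‖M‖ ^ 2) 3))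
  have h2 : |3 / max (‖M‖ ^ 2) 3 - 3 / max (‖M'‖ ^ 2) 3| * ‖M'‖ ≤ 2 * ‖M - M'‖ :=
    (truncFactor_aux ‖M‖ ‖M'‖ (max (‖M‖ ^ 2) 3) (max (‖M'‖ ^ 2) 3) (norm_nonneg _) (norm_nonneg _)
      (le_max_right (‖M‖ ^ 2) 3) (le_max_right (‖M'‖ ^ 2) 3) (le_max_left (‖M‖ ^ 2) 3)
      (le_max_left (‖M'‖ ^ 2) 3) (abs_max_sub_max_le_abs (‖M‖ ^ 2) (‖M'‖ ^ 2) (3 : ℝ))).trans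
      (by linarith [abs_norm_sub_norm_le M M'])
  linarith

end Frobenius


/-! ### Products of four bounded factors (the rooted plaquette loops) -/

section Products

variable {N : ℕ}

/-- `‖a b c d‖ ≤ s⁴` when all factors have Frobenius norm `≤ s`. [folklore] -/
theorem norm_mul4_le {a b c d : Matrix (Fin N) (Fin N) ℂ} {s : ℝ} (hs : 0 ≤ s) (ha : ‖a‖ ≤ s)
    (hb : ‖b‖ ≤ s) (hc : ‖c‖ ≤ s) (hd : ‖d‖ ≤ s) : ‖a * b * c * d‖ ≤ s ^ 4 := by
  calc ‖a * b * c * d‖ ≤ ‖a * b * c‖ * ‖d‖ := norm_mul_le _ _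
    _ ≤ ‖a * b‖ * ‖c‖ * ‖d‖ := by gcongr; exact norm_mul_le _ _
    _ ≤ ‖a‖ * ‖b‖ * ‖c‖ * ‖d‖ := by gcongr; exact norm_mul_le _ _
    _ ≤ s * s * s * s := by gcongr
    _ = s ^ 4 := by ring

/-- **Telescoping**: `‖a b c d − a' b' c' d'‖ ≤ 4 s³ δ` when all factors have norm `≤ s` and
corresponding factors differ by `≤ δ`. [folklore] -/
theorem norm_mul4_sub_mul4_le {a b c d a' b' c' d' : Matrix (Fin N) (Fin N) ℂ} {s δ : ℝ}
    (hs : 0 ≤ s) (hδ : 0 ≤ δ) (_ha : ‖a‖ ≤ s) (hb : ‖b‖ ≤ s) (hc : ‖c‖ ≤ s) (hd : ‖d‖ ≤ s)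
    (ha' : ‖a'‖ ≤ s) (hb' : ‖b'‖ ≤ s) (hc' : ‖c'‖ ≤ s) (_hd' : ‖d'‖ ≤ s)
    (hda : ‖a - a'‖ ≤ δ) (hdb : ‖b - b'‖ ≤ δ) (hdc : ‖c - c'‖ ≤ δ) (hdd : ‖d - d'‖ ≤ δ) :
    ‖a * b * c * d - a' * b' * c' * d'‖ ≤ 4 * s ^ 3 * δ := by
  have hid : a * b * c * d - a' * b' * c' * d' =
      (a - a') * b * c * d + a' * (b - b') * c * d + a' * b' * (c - c') * d + a' * b' * c' * (d - d') := by
    noncomm_ring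
  rw [hid]
  have h4 : ∀ (x y z w : Matrix (Fin N) (Fin N) ℂ), ‖x * y * z * w‖ ≤ ‖x‖ * ‖y‖ * ‖z‖ * ‖w‖ := by
    intro x y z w
    calc ‖x * y * z * w‖ ≤ ‖x * y * z‖ * ‖w‖ := norm_mul_le _ _
      _ ≤ ‖x * y‖ * ‖z‖ * ‖w‖ := by gcongr; exact norm_mul_le _ _
      _ ≤ ‖x‖ * ‖y‖ * ‖z‖ * ‖w‖ := by gcongr; exact norm_mul_le _ _
  calc ‖(a - a') * b * c * d + a' * (b - b') * c * d + a' * b' * (c - c') * d + a' * b' * c' * (d - d')‖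
      ≤ ‖(a - a') * b * c * d‖ + ‖a' * (b - b') * c * d‖ + ‖a' * b' * (c - c') * d‖ +
          ‖a' * b' * c' * (d - d')‖ := by
        refine (norm_add_le _ _).trans ?_
        gcongr
        refine (norm_add_le _ _).trans ?_
        gcongr
        exact norm_add_le _ _
    _ ≤ δ * s * s * s + s * δ * s * s + s * s * δ * s + s * s * s * δ := by
        gcongr
        · exact (h4 _ _ _ _).trans (by gcongr)
        · exact (h4 _ _ _ _).trans (by gcongr)
        · exact (h4 _ _ _ _).trans (by gcongr)
        · exact (h4 _ _ _ _).trans (by gcongr)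
    _ = 4 * s ^ 3 * δ := by ring

variable {d L : ℕ}

/-- The rooted plaquette loops of a configuration with links of norm `≤ s` have norm `≤ s⁴`
(`‖Qᴴ‖ = ‖Q‖`). [folklore] -/
theorem norm_rootedLoop_le {R : MatrixConfig d L N} {s : ℝ} (hs : 0 ≤ s) (hR : ∀ x, ‖R x‖ ≤ s)
    (e : Edge d L) (j : Fin d) (b : Bool) : ‖rootedLoop R e j b‖ ≤ s ^ 4 := by
  have hRt : ∀ x, ‖(R x)ᴴ‖ ≤ s := fun x => by rw [Matrix.frobenius_norm_conjTranspose]; exact hR x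
  cases b
  · exact norm_mul4_le hs (hR _) (hR _) (hRt _) (hRt _)
  · exact norm_mul4_le hs (hR _) (hRt _) (hRt _) (hR _)

/-- The rooted plaquette loops are Lipschitz in the links on bounded sets:
`‖loop(R) − loop(R')‖ ≤ 4 s³ δ` if all links have norm `≤ s` and differ by `≤ δ`. [folklore] -/
theorem norm_rootedLoop_sub_le {R R' : MatrixConfig d L N} {s δ : ℝ} (hs : 0 ≤ s) (hδ : 0 ≤ δ)
    (hR : ∀ x, ‖R x‖ ≤ s) (hR' : ∀ x, ‖R' x‖ ≤ s) (hRR' : ∀ x, ‖R x - R' x‖ ≤ δ)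
    (e : Edge d L) (j : Fin d) (b : Bool) : ‖rootedLoop R e j b - rootedLoop R' e j b‖ ≤ 4 * s ^ 3 * δ := by
  have hRt : ∀ x, ‖(R x)ᴴ‖ ≤ s := fun x => by rw [Matrix.frobenius_norm_conjTranspose]; exact hR x
  have hRt' : ∀ x, ‖(R' x)ᴴ‖ ≤ s := fun x => by rw [Matrix.frobenius_norm_conjTranspose]; exact hR' x
  have hdt : ∀ x, ‖(R x)ᴴ - (R' x)ᴴ‖ ≤ δ := fun x => by
    rw [← Matrix.conjTranspose_sub, Matrix.frobenius_norm_conjTranspose]; exact hRR' x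
  cases b
  · exact norm_mul4_sub_mul4_le hs hδ (hR _) (hR _) (hRt _) (hRt _) (hR' _) (hR' _) (hRt' _) (hRt' _)
      (hRR' _) (hRR' _) (hdt _) (hdt _)
  · exact norm_mul4_sub_mul4_le hs hδ (hR _) (hRt _) (hRt _) (hR _) (hR' _) (hRt' _) (hRt' _) (hR' _)
      (hRR' _) (hdt _) (hdt _) (hRR' _)

end Products

/-! ### The `𝔤`-valued drift on bounded configurations -/

section Drift

variable {G : Type*} [Group G] [TopologicalSpace G] (r : LatticeRep G) {L : ℕ}

/-- `‖driftLie β R e‖ ≤ |β| · 2(d−1)·… ≤ |β| · 6 · s⁴` on `(ℤ/L)³` when all links have norm `≤ s`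
(`𝐩` is a contraction; six rooted loops bound generously by the full `Fin 3 × Bool` sum). [folklore] -/
theorem norm_driftLie_le (β : ℝ) {R : MatrixConfig 3 L r.N} {s : ℝ} (hs : 0 ≤ s) (hR : ∀ x, ‖R x‖ ≤ s)
    (e : Edge 3 L) : ‖r.driftLie β R e‖ ≤ |β| * (6 * s ^ 4) := by
  rw [LatticeRep.driftLie, norm_smul, Real.norm_eq_abs]
  gcongr
  calc ‖∑ j ∈ univ.erase e.2, ∑ b : Bool, r.lieProj (rootedLoop R e j b)ᴴ‖
      ≤ ∑ j ∈ univ.erase e.2, ‖∑ b : Bool, r.lieProj (rootedLoop R e j b)ᴴ‖ := norm_sum_le _ _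
    _ ≤ ∑ j ∈ univ.erase e.2, ∑ b : Bool, ‖r.lieProj (rootedLoop R e j b)ᴴ‖ := by
        gcongr; exact norm_sum_le _ _
    _ ≤ ∑ j ∈ (univ : Finset (Fin 3)), ∑ b : Bool, s ^ 4 := by
        refine (Finset.sum_le_sum_of_subset_of_nonneg (Finset.erase_subset _ _)
          (fun _ _ _ => Finset.sum_nonneg fun _ _ => norm_nonneg _)).trans ?_
        gcongr with j _ b _
        refine (norm_lieProj_le r _).trans ?_
        rw [Matrix.frobenius_norm_conjTranspose]
        exact norm_rootedLoop_le hs hR e j b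
    _ = 6 * s ^ 4 := by simp; ring

/-- `driftLie` is Lipschitz in the links on bounded sets: `‖A(R) − A(R')‖ ≤ |β| · 6 · 4 s³ δ`. [folklore] -/
theorem norm_driftLie_sub_le (β : ℝ) {R R' : MatrixConfig 3 L r.N} {s δ : ℝ} (hs : 0 ≤ s)
    (hδ : 0 ≤ δ) (hR : ∀ x, ‖R x‖ ≤ s) (hR' : ∀ x, ‖R' x‖ ≤ s) (hRR' : ∀ x, ‖R x - R' x‖ ≤ δ)
    (e : Edge 3 L) : ‖r.driftLie β R e - r.driftLie β R' e‖ ≤ |β| * (6 * (4 * s ^ 3 * δ)) := by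
  rw [LatticeRep.driftLie, LatticeRep.driftLie, ← smul_sub, norm_smul, Real.norm_eq_abs,
    ← Finset.sum_sub_distrib]
  gcongr
  calc ‖∑ j ∈ univ.erase e.2, (∑ b : Bool, r.lieProj (rootedLoop R e j b)ᴴ -
          ∑ b : Bool, r.lieProj (rootedLoop R' e j b)ᴴ)‖
      ≤ ∑ j ∈ univ.erase e.2, ‖∑ b : Bool, r.lieProj (rootedLoop R e j b)ᴴ -
          ∑ b : Bool, r.lieProj (rootedLoop R' e j b)ᴴ‖ := norm_sum_le _ _
    _ ≤ ∑ j ∈ univ.erase e.2, ∑ b : Bool, ‖r.lieProj (rootedLoop R e j b)ᴴ -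
          r.lieProj (rootedLoop R' e j b)ᴴ‖ := by
        gcongr with j _
        rw [← Finset.sum_sub_distrib]
        exact norm_sum_le _ _
    _ ≤ ∑ j ∈ (univ : Finset (Fin 3)), ∑ b : Bool, 4 * s ^ 3 * δ := by
        refine (Finset.sum_le_sum_of_subset_of_nonneg (Finset.erase_subset _ _)
          (fun _ _ _ => Finset.sum_nonneg fun _ _ => norm_nonneg _)).trans ?_
        gcongr with j _ b _
        rw [← map_sub, ← Matrix.conjTranspose_sub]
        refine (norm_lieProj_le r _).trans ?_
        rw [Matrix.frobenius_norm_conjTranspose]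
        exact norm_rootedLoop_sub_le hs hδ hR hR' hRR' e j b
    _ = 6 * (4 * s ^ 3 * δ) := by simp; ring

end Drift



end Summit.QuantumFields.YangMills.Theorems.ColdStartUniversality

end
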